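import Literature.AlgebraicGeometry.Villaflor2022.LinearFormsCutLinearCycle
import HarnessLib

/-!
# The periods of a linear cycle of the Fermat variety over ALL linear cycles are integral
# (Villaflor, manuscripta math. 167 (2022), Cor. 4; Villaflor, CCM 24 (2022), Props. 5.1–5.2) — algebraic core

Certified instances and evidence bearing on the general Hodge conjecture; no claim.

R. Villaflor Loyola, *Periods of complete intersection algebraic cycles*, manuscripta math. 167 (2022)
= arXiv:1812.03964 [Villaflor2022PeriodsCI], Corollary 4 (held text pp. 13–14): for the Fermat variety
`X = {x_0^d + ⋯ + x_{n+1}^d = 0}` and `α_0, α_2, …, α_n ∈ {1, 3, …, 2d−1}`, the linear cycle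
`ℙ^{n/2}_α = {x_0 − ζ_{2d}^{α_0}x_1 = ⋯ = x_n − ζ_{2d}^{α_n}x_{n+1} = 0}` has associated polynomial
`P_δ = d^{n/2+1} ζ_{2d}^{α_0+⋯+α_n} ∏_j (Σ_{l=0}^{d−2} x_{2j−2}^{d−2−l} ζ_{2d}^{α_{2j−2}l} x_{2j−1}^l)`, "In particular
`ℙ^{n/2}_α · ℙ^{n/2}_β = (1 − (1−d)^{m+1})/d` where `m = dim ℙ^{n/2}_α ∩ ℙ^{n/2}_β`." Proof (p. 14): "We just need to
compute `c ∈ ℂ` such that `P_δ·P_μ ≡ c·d^{n+2}(d−1)^{n+2}(x_0⋯x_{n+1})^{d−2} (mod ⟨x_0^{d−1}, …, x_{n+1}^{d−1}⟩)` […]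
For every `j` […] `Σ_{l=0}^{d−2} ζ_{2d}^{α_{2j−2}(l+1)+β_{2j−2}(d−1−l)} = 1 − d` if `α_{2j−2} = β_{2j−2}`, `1` if
`α_{2j−2} ≠ β_{2j−2}`. Therefore `c(d−1)^{n+2} = (1−d)^{m+1}`."

R. Villaflor Loyola, *Small codimension components of the Hodge locus containing the Fermat variety*, Commun.
Contemp. Math. 24 (2022) = arXiv:2001.01019 [Villaflorloyola2021], §5 (held text p. 11): **Proposition 5.1**
(`P_λ·P_μ ≡ c·det(Hess F) (mod J^F)` "for some `c ∈ ℚ`" whenever `λ, μ` are Hodge cycles — "since both classes are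
rational, the resulting period must be a rational number"), **Proposition 5.2** (the polynomial `P_δ` of
`ℙ^{n/2}_α`, from [VillaPCIAC] = the Corollary above), the proof of Thm. 1.2 (p. 12:
`P_λ·P_δ ≡ c_α·(x_0⋯x_{n+1})^{d−2}`, `c_α ∈ ℚ`, for every linear cycle `δ`), and §6 (p. 13): the linear cycles of `X`
are "obtained from the `ℙ^{n/2}_α`'s after permuting the coordinates of `ℙ^{n+1}`". In the tree, hypothesis
**(H2)** of `Villaflor2022.exists_fakeLinearCycle_of_rational_periods` (Thm. 1.2 formalised) is exactly this:
the periods `ℓ(P_δ/c_δ)` of the class over ALL linear cycles `δ = (θ, c)` are rational multiples of one constant.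

## What this file PROVES (0 facts, 0 sorry), over any field `K`

The printed computation (Cor. 4) treats two linear cycles with the SAME pairing of the coordinates
(`{x_0,x_1}, {x_2,x_3}, …`); for a Hodge class and an arbitrary linear cycle the printed argument for rationality
(Prop. 5.1) is transcendental (the intersection number of two rational classes). Here the algebra is done for two
linear cycles in ARBITRARY mutual position:

* `linearCyclePairing_integral`: for finite types `ι`, `T`, twists `c : ι → K`, `c'' : T → K` with
  `c_j^d = −1 = c''_t^d` (`d ≥ 2`) and ANY bijection `ρ : T ⊕ T ≃ ι ⊕ ι` (the relative position of the two pairings),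
  `(∏_t c''_t) · ℓ_c(P_{c''} ∘ ρ) = z · ∏_j c_j^{−1}` with `z ∈ ℤ`, where `ℓ_c = fermatLinearCycleFunctional c (d−1)`
  is the period functional of the cycle `{x_{2j} = c_j x_{2j+1}}` (restrict and take the coefficient of
  `∏ y_j^{d−2}`; its values on monomials are MV18's periods, tree `MovasatiVillaflor2018.linearCycleFunctional_monomial`)
  and `(∏ c'')·P_{c''}` is Prop. 5.2's `P_δ/c_δ` (tree `fermatLinearCyclePolynomial`, `linearCyclePoly`);
  equivalently `linearCyclePairing_integral'`: `(∏ c_j)(∏ c''_t)·ℓ_c(P_{c''} ∘ ρ) ∈ ℤ`; in the same-pairing case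
  (`ρ = id`, only loops) each pair contributes a factor `±1` or `±(d−1)` (`loop_value`) — Cor. 4's
  `c(d−1)^{n+2} = (1−d)^{m+1}` with the printed constants `d^{n/2+1}`, `c_δ` dropped;
* `linearCycle_rational_periods`: consequently **(H2) HOLDS for the period functional `c'·ℓ_c ∘ rename θ₀⁻¹` of
  every genuine linear cycle** (with `c₀ = c'·∏ c_j^{−1}`), i.e. the formalised Thm. 1.2 is not vacuous: its
  hypotheses are satisfied by the linear cycles themselves.

Method (`slotSubst_prod_integral`, an induction on the number of pairs of `δ` not spelled out in print; the
printed route for general position is the period integral of [Villaflor2022PeriodsCI] Thm. 2/Cor. 2): substitute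
`x_s ↦ w_s·y_{π(s)}` (weights `(c_j, 1)` on the pair `j` of `λ`) into `∏_t P_t`,
`P_t = Σ_l x_{ρ(t,0)}^l (c''_t x_{ρ(t,1)})^{d−2−l}`, and read the coefficient of `∏_j y_j^{d−2}`. Invariant: on each
pair the two weights lie on the Fermat curve, `w_s^d + w_{s'}^d = 0`. A pair `t` with both coordinates in ONE pair
`j` of `λ` (a loop) contributes `c''_t·Σ_l A^lB^{d−2−l}` with `A^d = B^d`, which is `∓u_j` or `±(d−1)u_j`,
`u_j ∈ w_s^d/(w_sw_{s'})·{±1}` — exactly Cor. 4's dichotomy `1 − d` / `1` (`loop_value`, from `geom_sum` via the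
tree's `pairSum_mul_sub`, `pairSum_self`); a pair meeting two pairs `j₁ ≠ j₂` (a merge) is removed by
`Σ_l α^lβ^{d−2−l}·coeff_{y_{j₁}^{d−2−l}y_{j₂}^{l}}(R) = coeff_{Y^{d−2}}(R[y_{j₁} ↦ βY, y_{j₂} ↦ αY])`
(`coeff_mergeHom`), which glues the two pairs into one with weights `(βw_{s₁}, αw_{s₂})`, again on the Fermat
curve, and `u_{new} = u_{j₁}u_{j₂}/c''_t`.

References: [Villaflor2022PeriodsCI] Cor. 4; [Villaflorloyola2021] Props. 5.1, 5.2, proof of Thm. 1.2, §6;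
[MovasatiVillaflor2018] Thm. 1 (periods of linear cycles); the intersection matrix of all linear cycles of the
Fermat variety in arbitrary position is computed in [AljovinMovasatiVillaflor2019].
-/

noncomputable section

open MvPolynomial Finset Literature.AlgebraicGeometry.HodgeTheory

namespace Literature.AlgebraicGeometry.Villaflor2022

variable {K : Type*} [Field K] {ι T : Type*}

/-! ## The objects of the induction -/

/-- Substitution of the slots: `x_s ↦ w_s · y_{π(s)}` (restriction to a linear cycle with general weights; for
`π = (j ↦ j, j' ↦ j)`, `w = (c_j, 1)` this is the tree's `fermatLinearCycleSubst c`, see `slotSubst_std`).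
[cite: Villaflorloyola2021, Proposition 5.2] -/
def slotSubst (π : T ⊕ T → ι) (w : T ⊕ T → K) : MvPolynomial (T ⊕ T) K →ₐ[K] MvPolynomial ι K :=
  aeval fun s => C (w s) * X (π s)

/-- The target exponent `Σ_{j ∈ A} (d−2)·[y_j]` (for `A = univ`: the socle exponent `(d−2, …, d−2)`).
[cite: Villaflor2022PeriodsCI, Corollary 4] -/
def targetExp (d : ℕ) (A : Finset ι) : ι →₀ ℕ := ∑ j ∈ A, Finsupp.single j (d - 2)

/-- The slots of the pairs `t ∈ E` lying over the pair `j` of `λ`. [cite: Villaflorloyola2021, §6] -/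
def activeOver [DecidableEq ι] (π : T ⊕ T → ι) (E : Finset T) (j : ι) : Finset (T ⊕ T) :=
  (E.disjSum E).filter fun s => π s = j

/-- The gluing homomorphism `y_{j₁} ↦ β y_{j₁}`, `y_{j₂} ↦ α y_{j₁}`, `y_i ↦ y_i` otherwise.
[cite: Villaflorloyola2021, Proposition 5.1] -/
def mergeHom [DecidableEq ι] (j₁ j₂ : ι) (α β : K) : MvPolynomial ι K →ₐ[K] MvPolynomial ι K :=
  aeval fun i => if i = j₁ then C β * X j₁ else if i = j₂ then C α * X j₁ else X i

/-- Value of the target exponent. [cite: Villaflor2022PeriodsCI, Corollary 4] -/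
theorem targetExp_apply [DecidableEq ι] (d : ℕ) (A : Finset ι) (j : ι) :
    targetExp d A j = if j ∈ A then d - 2 else 0 := by
  simp only [targetExp, Finset.sum_apply', Finsupp.single_apply]
  rw [Finset.sum_ite_eq']

/-- Removing a pair from the target. [cite: Villaflor2022PeriodsCI, Corollary 4] -/
theorem targetExp_erase [DecidableEq ι] (d : ℕ) {A : Finset ι} {j : ι} (hj : j ∈ A) :
    targetExp d A = targetExp d (A.erase j) + Finsupp.single j (d - 2) := by
  rw [targetExp, targetExp, ← Finset.add_sum_erase A _ hj, add_comm]

/-- Double update, first slot. [folklore] -/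
private theorem upd_fst {j₁ j₂ : ι} (hj : j₁ ≠ j₂) (s : ι →₀ ℕ) (x y : ℕ) :
    ((s.update j₁ x).update j₂ y) j₁ = x := by
  classical
  rw [Finsupp.update_apply, if_neg hj, Finsupp.update_apply, if_pos rfl]

/-- Double update, second slot. [folklore] -/
private theorem upd_snd (j₁ j₂ : ι) (s : ι →₀ ℕ) (x y : ℕ) : ((s.update j₁ x).update j₂ y) j₂ = y := by
  classical
  rw [Finsupp.update_apply, if_pos rfl]

/-- Double update, elsewhere. [folklore] -/
private theorem upd_ne {i j₁ j₂ : ι} (h1 : i ≠ j₁) (h2 : i ≠ j₂) (s : ι →₀ ℕ) (x y : ℕ) :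
    ((s.update j₁ x).update j₂ y) i = s i := by
  classical
  rw [Finsupp.update_apply, if_neg h2, Finsupp.update_apply, if_neg h1]

/-! ## The gluing homomorphism on coefficients -/

/-- The image of a monomial under the gluing map: `y^s ↦ β^{s_{j₁}} α^{s_{j₂}} · y^{s'}`, where `s'` moves the
exponent of `y_{j₂}` onto `y_{j₁}`. [folklore] -/
private theorem mergeHom_monomial [Fintype ι] [DecidableEq ι] {j₁ j₂ : ι} (hj : j₁ ≠ j₂) (α β : K)
    (s : ι →₀ ℕ) (r : K) :
    mergeHom j₁ j₂ α β (monomial s r) =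
      monomial ((s.update j₁ (s j₁ + s j₂)).update j₂ 0) (r * (β ^ s j₁ * α ^ s j₂)) := by
  rw [mergeHom, aeval_monomial, Finsupp.prod_pow, monomial_eq, Finsupp.prod_pow, MvPolynomial.algebraMap_eq]
  -- split off the factors at `j₁` and `j₂` on both sides
  have hj2 : j₂ ∈ (univ : Finset ι).erase j₁ := Finset.mem_erase.mpr ⟨hj.symm, Finset.mem_univ _⟩
  rw [← Finset.mul_prod_erase _ _ (Finset.mem_univ j₁), ← Finset.mul_prod_erase _ _ hj2,
    ← Finset.mul_prod_erase (univ : Finset ι) _ (Finset.mem_univ j₁), ← Finset.mul_prod_erase _ _ hj2]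
  have hrest : ∏ i ∈ ((univ : Finset ι).erase j₁).erase j₂,
      (if i = j₁ then C β * X j₁ else if i = j₂ then C α * X j₁ else (X i : MvPolynomial ι K)) ^ s i =
      ∏ i ∈ ((univ : Finset ι).erase j₁).erase j₂,
        (X i : MvPolynomial ι K) ^ ((s.update j₁ (s j₁ + s j₂)).update j₂ 0) i := by
    refine Finset.prod_congr rfl fun i hi => ?_
    have h2 : i ≠ j₂ := (Finset.mem_erase.mp hi).1
    have h1 : i ≠ j₁ := (Finset.mem_erase.mp (Finset.mem_erase.mp hi).2).1
    rw [if_neg h1, if_neg h2, upd_ne h1 h2]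
  rw [hrest, if_pos rfl, if_neg hj.symm, if_pos rfl, upd_fst hj, upd_snd, pow_zero, one_mul, mul_pow, mul_pow,
    ← map_pow, ← map_pow, map_mul, map_mul, pow_add]
  ring

/-- When does the glued monomial hit a given exponent `m` with `m_{j₂} = 0`? [folklore] -/
private theorem update_update_eq_iff {j₁ j₂ : ι} (hj : j₁ ≠ j₂) (s m : ι →₀ ℕ) (hm : m j₂ = 0) :
    (s.update j₁ (s j₁ + s j₂)).update j₂ 0 = m ↔
      s = (m.update j₁ (m j₁ - s j₂)).update j₂ (s j₂) ∧ s j₂ ≤ m j₁ := by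
  constructor
  · intro h
    have h1 : s j₁ + s j₂ = m j₁ := by rw [← h, upd_fst hj]
    refine ⟨?_, by omega⟩
    ext i
    by_cases hi2 : i = j₂
    · rw [hi2, upd_snd]
    · by_cases hi1 : i = j₁
      · rw [hi1, upd_fst hj]; omega
      · rw [upd_ne hi1 hi2, ← h, upd_ne hi1 hi2]
  · rintro ⟨h, hle⟩
    ext i
    by_cases hi2 : i = j₂
    · rw [hi2, upd_snd, hm]
    · by_cases hi1 : i = j₁
      · rw [hi1, upd_fst hj]
        have e1 := DFunLike.congr_fun h j₁
        rw [upd_fst hj] at e1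
        omega
      · rw [upd_ne hi1 hi2]
        have e := DFunLike.congr_fun h i
        rw [upd_ne hi1 hi2] at e
        exact e

/-- **The gluing identity on coefficients.** For `m` with `m_{j₂} = 0`:
`coeff_m(R[y_{j₁} ↦ βy_{j₁}, y_{j₂} ↦ αy_{j₁}]) = Σ_{l ≤ m_{j₁}} α^l β^{m_{j₁}−l} coeff_{m[j₁ ↦ m_{j₁}−l, j₂ ↦ l]}(R)`.
[cite: Villaflorloyola2021, Proposition 5.1] -/
theorem coeff_mergeHom [Fintype ι] [DecidableEq ι] {j₁ j₂ : ι} (hj : j₁ ≠ j₂) (α β : K) (R : MvPolynomial ι K)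
    (m : ι →₀ ℕ) (hm : m j₂ = 0) :
    coeff m (mergeHom j₁ j₂ α β R) =
      ∑ l ∈ range (m j₁ + 1), α ^ l * β ^ (m j₁ - l) * coeff ((m.update j₁ (m j₁ - l)).update j₂ l) R := by
  induction R using MvPolynomial.induction_on' with
  | monomial s r =>
    rw [mergeHom_monomial hj, coeff_monomial]
    simp_rw [coeff_monomial]
    by_cases hfit : (s.update j₁ (s j₁ + s j₂)).update j₂ 0 = m
    · rw [if_pos hfit]
      obtain ⟨hs, hle⟩ := (update_update_eq_iff hj s m hm).mp hfit
      have e1 : s j₁ + s j₂ = m j₁ := by rw [← hfit, upd_fst hj]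
      rw [Finset.sum_eq_single (s j₂)]
      · rw [if_pos hs, show m j₁ - s j₂ = s j₁ by omega]
        ring
      · intro l _ hl
        rw [if_neg, mul_zero]
        intro h
        apply hl
        have e := DFunLike.congr_fun h j₂
        rw [upd_snd] at e
        exact e.symm
      · intro h
        exact absurd (Finset.mem_range.mpr (by omega)) h
    · rw [if_neg hfit]
      symm
      refine Finset.sum_eq_zero fun l hl => ?_
      rw [if_neg, mul_zero]
      intro h
      apply hfit
      rw [Finset.mem_range] at hl
      have hl2 : s j₂ = l := by
        have e := DFunLike.congr_fun h j₂
        rwa [upd_snd] at e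
      refine (update_update_eq_iff hj s m hm).mpr ⟨?_, by omega⟩
      rw [hl2]
      exact h
  | add p q hp hq =>
    rw [map_add, coeff_add, hp, hq, ← Finset.sum_add_distrib]
    refine Finset.sum_congr rfl fun l _ => ?_
    rw [coeff_add]
    ring

/-! ## The value of one pair: loops (Cor. 4: `1 − d` if `α_j = β_j`, `1` otherwise) -/

/-- **Loop value.** If `a^d + b^d = 0`, `c^d = −1`, `a, b ≠ 0` and `u·(ab) ∈ {a^d, b^d}`, then
`c · Σ_{l<d−1} a^l (cb)^{d−2−l} = m·u` with `m ∈ {±1, ±(d−1)} ⊂ ℤ` (`(cb)^d = a^d`: a geometric sum between two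
`d`-th roots of the same number — Cor. 4's "`1 − d` if `α_{2j−2} = β_{2j−2}`, `1` if `α_{2j−2} ≠ β_{2j−2}`").
[cite: Villaflor2022PeriodsCI, Corollary 4 (proof)] -/
theorem loop_value {d : ℕ} (hd : 2 ≤ d) {a b c u : K} (hab : a ^ d + b ^ d = 0) (hc : c ^ d = -1) (ha : a ≠ 0)
    (hb : b ≠ 0) (hu : u * (a * b) = a ^ d ∨ u * (a * b) = b ^ d) :
    ∃ m : ℤ, c * pairSum (d - 1) a (c * b) = m * u := by
  have hBd : (c * b) ^ d = a ^ d := by rw [mul_pow, hc]; linear_combination (-1 : K) * hab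
  have hab0 : a * b ≠ 0 := mul_ne_zero ha hb
  -- it suffices to compute `c · pairSum · (ab)`
  suffices H : ∃ m : ℤ, c * pairSum (d - 1) a (c * b) * (a * b) = m * (u * (a * b)) by
    obtain ⟨m, hm⟩ := H
    exact ⟨m, mul_right_cancel₀ hab0 (by rw [hm, mul_assoc])⟩
  by_cases hAB : a = c * b
  · -- equal roots: `pairSum = (d−1) a^{d−2}`
    have hval : c * pairSum (d - 1) a (c * b) * (a * b) = ((d - 1 : ℕ) : K) * a ^ d := by
      rw [← hAB, pairSum_self, show d - 1 - 1 = d - 2 by omega]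
      calc c * (((d - 1 : ℕ) : K) * a ^ (d - 2)) * (a * b)
          = ((d - 1 : ℕ) : K) * (a ^ (d - 2) * a * (c * b)) := by ring
        _ = ((d - 1 : ℕ) : K) * a ^ d := by
          rw [← hAB, ← pow_succ, ← pow_succ, show d - 2 + 1 + 1 = d by omega]
    rcases hu with hu | hu
    · exact ⟨(d - 1 : ℕ), by rw [hval, hu]; push_cast; ring⟩
    · exact ⟨-((d - 1 : ℕ) : ℤ), by rw [hval, hu]; push_cast; linear_combination ((d - 1 : ℕ) : K) * hab⟩
  · -- distinct roots: `pairSum · (a·cb) = −a^d`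
    have hsub : a - c * b ≠ 0 := sub_ne_zero.mpr hAB
    have key : pairSum (d - 1) a (c * b) * (a * (c * b)) = -a ^ d := by
      have h1 := pairSum_mul_sub (d - 1) a (c * b)
      have h2 : a ^ (d - 1) * a = a ^ d := by rw [← pow_succ, show d - 1 + 1 = d by omega]
      have h3 : (c * b) ^ (d - 1) * (c * b) = a ^ d := by rw [← pow_succ, show d - 1 + 1 = d by omega, hBd]
      apply mul_right_cancel₀ hsub
      linear_combination (a * (c * b)) * h1 + (c * b) * h2 - a * h3
    have hval : c * pairSum (d - 1) a (c * b) * (a * b) = -a ^ d := by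
      linear_combination key
    rcases hu with hu | hu
    · exact ⟨-1, by rw [hval, hu]; push_cast; ring⟩
    · exact ⟨1, by rw [hval, hu]; push_cast; linear_combination (-1 : K) * hab⟩

/-! ## One pair after the substitution -/

/-- Substituting into the `0`-dimensional factor of a pair `t`:
`P_t ↦ Σ_l (w_{t0} y_{π(t0)})^l (c_t w_{t1} y_{π(t1)})^{d−2−l}`. [cite: Villaflorloyola2021, Proposition 5.2] -/
theorem slotSubst_fermatLinearCycleFactor (d : ℕ) (π : T ⊕ T → ι) (w : T ⊕ T → K) (c : T → K) (t : T) :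
    slotSubst π w (fermatLinearCycleFactor c (d - 1) t) =
      ∑ l ∈ range (d - 1), (C (w (Sum.inl t)) * X (π (Sum.inl t))) ^ l *
        (C (c t * w (Sum.inr t)) * X (π (Sum.inr t))) ^ (d - 1 - 1 - l) := by
  simp only [slotSubst, fermatLinearCycleFactor, map_sum, map_mul, map_pow, aeval_X, aeval_C,
    MvPolynomial.algebraMap_eq]
  refine Finset.sum_congr rfl fun l _ => ?_
  ring

/-- A loop: both slots over the same `j` give `pairSum(w_{t0}, c_t w_{t1}) · y_j^{d−2}`.
[cite: Villaflor2022PeriodsCI, Corollary 4 (proof)] -/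
theorem slotSubst_fermatLinearCycleFactor_loop (d : ℕ) (hd : 2 ≤ d) (π : T ⊕ T → ι) (w : T ⊕ T → K)
    (c : T → K) (t : T) (h : π (Sum.inl t) = π (Sum.inr t)) :
    slotSubst π w (fermatLinearCycleFactor c (d - 1) t) =
      C (pairSum (d - 1) (w (Sum.inl t)) (c t * w (Sum.inr t))) * X (π (Sum.inl t)) ^ (d - 2) := by
  rw [slotSubst_fermatLinearCycleFactor, pairSum, map_sum, Finset.sum_mul]
  refine Finset.sum_congr rfl fun l hl => ?_
  rw [Finset.mem_range] at hl
  rw [← h, mul_pow, mul_pow, ← map_pow, ← map_pow, map_mul]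
  have : (X (π (Sum.inl t)) : MvPolynomial ι K) ^ l * X (π (Sum.inl t)) ^ (d - 1 - 1 - l) =
      X (π (Sum.inl t)) ^ (d - 2) := by
    rw [← pow_add]; congr 1; omega
  linear_combination (C (w (Sum.inl t) ^ l) * C ((c t * w (Sum.inr t)) ^ (d - 1 - 1 - l)) : MvPolynomial ι K) * this

/-- The substituted factor as a sum of monomials `α^l β^{d−2−l} · y_{π(t0)}^l y_{π(t1)}^{d−2−l}`, `α = w_{t0}`,
`β = c_t w_{t1}`. [cite: Villaflorloyola2021, Proposition 5.2] -/
theorem slotSubst_fermatLinearCycleFactor_eq_sum_monomial (d : ℕ) (π : T ⊕ T → ι) (w : T ⊕ T → K) (c : T → K)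
    (t : T) :
    slotSubst π w (fermatLinearCycleFactor c (d - 1) t) =
      ∑ l ∈ range (d - 1), monomial (Finsupp.single (π (Sum.inl t)) l +
        Finsupp.single (π (Sum.inr t)) (d - 1 - 1 - l)) (w (Sum.inl t) ^ l * (c t * w (Sum.inr t)) ^ (d - 1 - 1 - l)) := by
  rw [slotSubst_fermatLinearCycleFactor]
  refine Finset.sum_congr rfl fun l _ => ?_
  rw [mul_pow, mul_pow, ← map_pow, ← map_pow, X_pow_eq_monomial, X_pow_eq_monomial, C_mul_monomial,
    C_mul_monomial, monomial_mul, mul_one, mul_one]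

/-! ## Bookkeeping of the slots -/

/-- Slots of `E.erase t₀` are the slots of `E` other than the two slots of `t₀`. [folklore] -/
private theorem mem_disjSum_erase [DecidableEq T] {E : Finset T} {t₀ : T} {s : T ⊕ T} :
    s ∈ (E.erase t₀).disjSum (E.erase t₀) ↔ s ∈ E.disjSum E ∧ s ≠ Sum.inl t₀ ∧ s ≠ Sum.inr t₀ := by
  rcases s with t | t
  · rw [Finset.inl_mem_disjSum, Finset.inl_mem_disjSum, Finset.mem_erase]
    constructor
    · rintro ⟨ht, hE⟩
      exact ⟨hE, fun h => ht (Sum.inl_injective h), Sum.inl_ne_inr⟩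
    · rintro ⟨hE, h1, -⟩
      exact ⟨fun h => h1 (by rw [h]), hE⟩
  · rw [Finset.inr_mem_disjSum, Finset.inr_mem_disjSum, Finset.mem_erase]
    constructor
    · rintro ⟨ht, hE⟩
      exact ⟨hE, Sum.inr_ne_inl, fun h => ht (Sum.inr_injective h)⟩
    · rintro ⟨hE, -, h2⟩
      exact ⟨fun h => h2 (by rw [h]), hE⟩

/-- Membership in `activeOver`. [folklore] -/
private theorem mem_activeOver [DecidableEq ι] {π : T ⊕ T → ι} {E : Finset T} {j : ι} {s : T ⊕ T} :
    s ∈ activeOver π E j ↔ s ∈ E.disjSum E ∧ π s = j := Finset.mem_filter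

/-- From `activeOver = {s, s'}` and a member `a`, the other member. [folklore] -/
private theorem other_of_pair [DecidableEq ι] [DecidableEq T] (d : ℕ) {π : T ⊕ T → ι} {E : Finset T} {j : ι}
    {s s' a : T ⊕ T} {w : T ⊕ T → K} (hss : s ≠ s') (hE : activeOver π E j = {s, s'})
    (hw : w s ^ d + w s' ^ d = 0) (ha : a ∈ activeOver π E j) :
    ∃ b, b ≠ a ∧ activeOver π E j = {a, b} ∧ w a ^ d + w b ^ d = 0 := by
  rw [hE, Finset.mem_insert, Finset.mem_singleton] at ha
  rcases ha with rfl | rfl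
  · exact ⟨s', hss.symm, hE, hw⟩
  · exact ⟨s, hss, by rw [hE, Finset.pair_comm], by rw [add_comm]; exact hw⟩

/-! ## The loop/merge induction -/

/-- **The loop/merge induction** (see the module doc): the substituted product over the pairs in `E`, read at
the exponent `(d−2)` on the pairs in `A`, is an integer multiple of `∏_{j∈A} u_j`, for every configuration of
weights on the Fermat curve (`w_s^d + w_{s'}^d = 0` on each pair) with `u_j ∏_{pair j} w = w_s^d`.
[cite: Villaflor2022PeriodsCI, Corollary 4 (proof)] [cite: Villaflorloyola2021, Propositions 5.1 and 5.2] -/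
theorem slotSubst_prod_integral [Fintype ι] [DecidableEq ι] [DecidableEq T] (d : ℕ) (hd : 2 ≤ d) (c : T → K) :
    ∀ (n : ℕ) (E : Finset T) (A : Finset ι) (π : T ⊕ T → ι) (w : T ⊕ T → K) (u : ι → K),
      E.card = n →
      (∀ s ∈ E.disjSum E, π s ∈ A) →
      (∀ j ∈ A, ∃ s s', s ≠ s' ∧ activeOver π E j = {s, s'} ∧ w s ^ d + w s' ^ d = 0) →
      (∀ s ∈ E.disjSum E, w s ≠ 0) →
      (∀ j ∈ A, ∃ s ∈ activeOver π E j, u j * ∏ s' ∈ activeOver π E j, w s' = w s ^ d) →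
      (∀ t ∈ E, c t ^ d = -1) →
      ∃ z : ℤ, (∏ t ∈ E, c t) *
          coeff (targetExp d A) (slotSubst π w (∏ t ∈ E, fermatLinearCycleFactor c (d - 1) t)) =
        z * ∏ j ∈ A, u j := by
  intro n
  induction n with
  | zero =>
    intro E A π w u hcard hact htwo _ _ _
    rw [Finset.card_eq_zero] at hcard
    subst hcard
    -- no slots, hence no pairs in `A`
    have hA : A = ∅ := by
      rw [Finset.eq_empty_iff_forall_notMem]
      intro j hj
      obtain ⟨s, s', _, hE, _⟩ := htwo j hj
      have hs : s ∈ activeOver π (∅ : Finset T) j := by rw [hE]; exact Finset.mem_insert_self _ _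
      rw [mem_activeOver] at hs
      simp at hs
    subst hA
    refine ⟨1, ?_⟩
    simp [targetExp]
  | succ n ih =>
    intro E A π w u hcard hact htwo hw0 hu hc
    obtain ⟨t₀, ht₀⟩ : E.Nonempty := Finset.card_pos.mp (by omega)
    have ha : (Sum.inl t₀ : T ⊕ T) ∈ E.disjSum E := Finset.inl_mem_disjSum.mpr ht₀
    have hb : (Sum.inr t₀ : T ⊕ T) ∈ E.disjSum E := Finset.inr_mem_disjSum.mpr ht₀
    have hab : (Sum.inl t₀ : T ⊕ T) ≠ Sum.inr t₀ := Sum.inl_ne_inr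
    obtain ⟨j₁, hj₁⟩ : ∃ j, π (Sum.inl t₀) = j := ⟨_, rfl⟩
    obtain ⟨j₂, hj₂⟩ : ∃ j, π (Sum.inr t₀) = j := ⟨_, rfl⟩
    have hj₁A : j₁ ∈ A := hj₁ ▸ hact _ ha
    have hj₂A : j₂ ∈ A := hj₂ ▸ hact _ hb
    have hcE' : (E.erase t₀).card = n := by rw [Finset.card_erase_of_mem ht₀, hcard, Nat.add_sub_cancel]
    have hct₀ : c t₀ ^ d = -1 := hc t₀ ht₀
    have hc0 : c t₀ ≠ 0 := by
      intro h; rw [h, zero_pow (by omega)] at hct₀; norm_num at hct₀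
    -- the other slots over `j₁`, `j₂`
    obtain ⟨x₁, y₁, hxy₁, hE₁, hw₁⟩ := htwo j₁ hj₁A
    obtain ⟨s₁, hs₁a, hE₁', hw₁'⟩ := other_of_pair d hxy₁ hE₁ hw₁ (mem_activeOver.mpr ⟨ha, hj₁⟩)
    obtain ⟨x₂, y₂, hxy₂, hE₂, hw₂⟩ := htwo j₂ hj₂A
    obtain ⟨s₂, hs₂b, hE₂', hw₂'⟩ := other_of_pair d hxy₂ hE₂ hw₂ (mem_activeOver.mpr ⟨hb, hj₂⟩)
    have hs₁ : s₁ ∈ E.disjSum E ∧ π s₁ = j₁ :=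
      mem_activeOver.mp (by rw [hE₁']; exact Finset.mem_insert.mpr (Or.inr (Finset.mem_singleton_self _)))
    have hs₂ : s₂ ∈ E.disjSum E ∧ π s₂ = j₂ :=
      mem_activeOver.mp (by rw [hE₂']; exact Finset.mem_insert.mpr (Or.inr (Finset.mem_singleton_self _)))
    -- split off the pair `t₀`
    rw [← Finset.mul_prod_erase E c ht₀, ← Finset.mul_prod_erase E (fermatLinearCycleFactor c (d - 1)) ht₀,
      map_mul]
    obtain ⟨R, hR⟩ : ∃ R, slotSubst π w (∏ t ∈ E.erase t₀, fermatLinearCycleFactor c (d - 1) t) = R := ⟨_, rfl⟩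
    rw [hR]
    by_cases hj : j₁ = j₂
    · /- LOOP: both slots of `t₀` lie over `j₁`; `{t₀0, t₀1}` are the two slots over `j₁`. -/
      have hbs₁ : Sum.inr t₀ = s₁ := by
        have h : (Sum.inr t₀ : T ⊕ T) ∈ activeOver π E j₁ := mem_activeOver.mpr ⟨hb, hj₂.trans hj.symm⟩
        rw [hE₁', Finset.mem_insert, Finset.mem_singleton] at h
        exact h.resolve_left hab.symm
      have hsub : ∀ s, s ∈ (E.erase t₀).disjSum (E.erase t₀) → s ∈ E.disjSum E ∧ π s ≠ j₁ := by
        intro s hs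
        rw [mem_disjSum_erase] at hs
        refine ⟨hs.1, fun h => ?_⟩
        have h' : s ∈ activeOver π E j₁ := mem_activeOver.mpr ⟨hs.1, h⟩
        rw [hE₁', ← hbs₁, Finset.mem_insert, Finset.mem_singleton] at h'
        exact h'.elim hs.2.1 hs.2.2
      have hover : ∀ j, j ≠ j₁ → activeOver π (E.erase t₀) j = activeOver π E j := by
        intro j hj'
        ext s
        rw [mem_activeOver, mem_activeOver, mem_disjSum_erase]
        constructor
        · rintro ⟨⟨h1, _, _⟩, h2⟩
          exact ⟨h1, h2⟩
        · rintro ⟨h1, h2⟩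
          refine ⟨⟨h1, fun h => hj' ?_, fun h => hj' ?_⟩, h2⟩
          · rw [← h2, h, hj₁]
          · rw [← h2, h, hj₂, ← hj]
      obtain ⟨z, hz⟩ := ih (E.erase t₀) (A.erase j₁) π w u hcE'
        (fun s hs => Finset.mem_erase.mpr ⟨(hsub s hs).2, hact s (hsub s hs).1⟩)
        (fun j hj' => by
          rw [hover j (Finset.mem_erase.mp hj').1]; exact htwo j (Finset.mem_erase.mp hj').2)
        (fun s hs => hw0 s (hsub s hs).1)
        (fun j hj' => by
          rw [hover j (Finset.mem_erase.mp hj').1]; exact hu j (Finset.mem_erase.mp hj').2)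
        (fun t ht => hc t (Finset.mem_erase.mp ht).2)
      rw [hR] at hz
      -- the value of the loop
      obtain ⟨s, hs, hus⟩ := hu j₁ hj₁A
      rw [hE₁', ← hbs₁, Finset.prod_pair hab] at hus
      rw [hE₁', ← hbs₁, Finset.mem_insert, Finset.mem_singleton] at hs
      have hus' : u j₁ * (w (Sum.inl t₀) * w (Sum.inr t₀)) = w (Sum.inl t₀) ^ d ∨
          u j₁ * (w (Sum.inl t₀) * w (Sum.inr t₀)) = w (Sum.inr t₀) ^ d := by
        rcases hs with hs | hs
        · rw [hs] at hus; exact Or.inl hus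
        · rw [hs] at hus; exact Or.inr hus
      have hwab : w (Sum.inl t₀) ^ d + w (Sum.inr t₀) ^ d = 0 := by rw [hbs₁]; exact hw₁'
      obtain ⟨m, hm⟩ := loop_value hd hwab hct₀ (hw0 _ ha) (hw0 _ hb) hus'
      refine ⟨m * z, ?_⟩
      rw [slotSubst_fermatLinearCycleFactor_loop d hd π w c t₀ (hj₁.trans (hj.trans hj₂.symm)),
        targetExp_erase d hj₁A, X_pow_eq_monomial, C_mul_monomial, mul_one, hj₁,
        add_comm (targetExp d (A.erase j₁)), coeff_monomial_mul', if_pos le_self_add, add_tsub_cancel_left,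
        ← Finset.mul_prod_erase A u hj₁A]
      push_cast
      linear_combination (u j₁ * (m : K)) * hz + (∏ t ∈ E.erase t₀, c t) * coeff (targetExp d (A.erase j₁)) R * hm
    · /- MERGE: glue the pairs `j₁ ≠ j₂` along `t₀`. -/
      have hs₁b : s₁ ≠ Sum.inr t₀ := fun h => hj (by rw [← hs₁.2, h, hj₂])
      have hs₂a : s₂ ≠ Sum.inl t₀ := fun h => hj (by rw [← hs₂.2, h, hj₁])
      have hs₁₂ : s₁ ≠ s₂ := fun h => hj (by rw [← hs₁.2, ← hs₂.2, h])
      -- the new configuration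
      obtain ⟨π', hπ'⟩ : ∃ π' : T ⊕ T → ι, ∀ s, π' s = if π s = j₂ then j₁ else π s := ⟨_, fun _ => rfl⟩
      obtain ⟨w', hw'⟩ : ∃ w' : T ⊕ T → K, ∀ s, w' s =
          if π s = j₁ then c t₀ * w (Sum.inr t₀) * w s else if π s = j₂ then w (Sum.inl t₀) * w s else w s :=
        ⟨_, fun _ => rfl⟩
      obtain ⟨u', hu'⟩ : ∃ u' : ι → K, ∀ j, u' j = if j = j₁ then u j₁ * u j₂ / c t₀ else u j :=
        ⟨_, fun _ => rfl⟩
      have hπ'_of_ne : ∀ s, π s ≠ j₂ → π' s = π s := fun s h => by rw [hπ', if_neg h]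
      have hπ'_of_eq : ∀ s, π s = j₂ → π' s = j₁ := fun s h => by rw [hπ', if_pos h]
      have hw'_off : ∀ s, π s ≠ j₁ → π s ≠ j₂ → w' s = w s := fun s h1 h2 => by
        rw [hw', if_neg h1, if_neg h2]
      have hw'_on₁ : ∀ s, π s = j₁ → w' s = c t₀ * w (Sum.inr t₀) * w s := fun s h => by rw [hw', if_pos h]
      have hw'_on₂ : ∀ s, π s = j₂ → w' s = w (Sum.inl t₀) * w s := fun s h => by
        rw [hw', if_neg (fun h' => hj (h'.symm.trans h)), if_pos h]
      have hw'₁ : w' s₁ = c t₀ * w (Sum.inr t₀) * w s₁ := hw'_on₁ s₁ hs₁.2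
      have hw'₂ : w' s₂ = w (Sum.inl t₀) * w s₂ := hw'_on₂ s₂ hs₂.2
      have hu'₁ : u' j₁ = u j₁ * u j₂ / c t₀ := by rw [hu', if_pos rfl]
      have hu'_of_ne : ∀ j, j ≠ j₁ → u' j = u j := fun j h => by rw [hu', if_neg h]
      have hover₁ : activeOver π' (E.erase t₀) j₁ = {s₁, s₂} := by
        ext s
        rw [mem_activeOver, mem_disjSum_erase, Finset.mem_insert, Finset.mem_singleton]
        constructor
        · rintro ⟨⟨hs, hsa, hsb⟩, hπs⟩
          by_cases h2 : π s = j₂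
          · have h' : s ∈ activeOver π E j₂ := mem_activeOver.mpr ⟨hs, h2⟩
            rw [hE₂', Finset.mem_insert, Finset.mem_singleton] at h'
            exact Or.inr (h'.resolve_left hsb)
          · rw [hπ'_of_ne s h2] at hπs
            have h' : s ∈ activeOver π E j₁ := mem_activeOver.mpr ⟨hs, hπs⟩
            rw [hE₁', Finset.mem_insert, Finset.mem_singleton] at h'
            exact Or.inl (h'.resolve_left hsa)
        · rintro (h | h) <;> rw [h]
          · exact ⟨⟨hs₁.1, hs₁a, hs₁b⟩, by rw [hπ'_of_ne s₁ (by rw [hs₁.2]; exact hj), hs₁.2]⟩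
          · exact ⟨⟨hs₂.1, hs₂a, hs₂b⟩, hπ'_of_eq s₂ hs₂.2⟩
      have hover : ∀ j, j ≠ j₁ → j ≠ j₂ → activeOver π' (E.erase t₀) j = activeOver π E j := by
        intro j hj1 hj2
        ext s
        rw [mem_activeOver, mem_activeOver, mem_disjSum_erase]
        constructor
        · rintro ⟨⟨hs, _, _⟩, hπs⟩
          by_cases h2 : π s = j₂
          · rw [hπ'_of_eq s h2] at hπs; exact absurd hπs.symm hj1
          · rw [hπ'_of_ne s h2] at hπs; exact ⟨hs, hπs⟩
        · rintro ⟨hs, hπs⟩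
          have h2 : π s ≠ j₂ := by rw [hπs]; exact hj2
          refine ⟨⟨hs, fun h => hj1 ?_, fun h => hj2 ?_⟩, by rw [hπ'_of_ne s h2, hπs]⟩
          · rw [← hπs, h, hj₁]
          · rw [← hπs, h, hj₂]
      -- the new pair lies on the Fermat curve
      have hferm : (c t₀ * w (Sum.inr t₀) * w s₁) ^ d + (w (Sum.inl t₀) * w s₂) ^ d = 0 := by
        rw [mul_pow, mul_pow, mul_pow, hct₀]
        linear_combination (-(w (Sum.inr t₀) ^ d)) * hw₁' + (w (Sum.inl t₀) ^ d) * hw₂'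
      -- the hypotheses of the induction for the new configuration
      have hact' : ∀ s ∈ (E.erase t₀).disjSum (E.erase t₀), π' s ∈ A.erase j₂ := by
        intro s hs
        obtain ⟨hsE, -, -⟩ := mem_disjSum_erase.mp hs
        by_cases h2 : π s = j₂
        · rw [hπ'_of_eq s h2]; exact Finset.mem_erase.mpr ⟨hj, hj₁A⟩
        · rw [hπ'_of_ne s h2]; exact Finset.mem_erase.mpr ⟨h2, hact s hsE⟩
      have htwo' : ∀ j ∈ A.erase j₂, ∃ s s', s ≠ s' ∧ activeOver π' (E.erase t₀) j = {s, s'} ∧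
          w' s ^ d + w' s' ^ d = 0 := by
        intro j hj'
        obtain ⟨hj2, hjA⟩ := Finset.mem_erase.mp hj'
        by_cases hj1 : j = j₁
        · rw [hj1]
          exact ⟨s₁, s₂, hs₁₂, hover₁, by rw [hw'₁, hw'₂]; exact hferm⟩
        · obtain ⟨s, s', hss, hE, hws⟩ := htwo j hjA
          have hsj : π s = j := (mem_activeOver.mp (by rw [hE]; exact Finset.mem_insert_self _ _)).2
          have hs'j : π s' = j :=
            (mem_activeOver.mp (by rw [hE]; exact Finset.mem_insert.mpr (Or.inr (Finset.mem_singleton_self _)))).2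
          refine ⟨s, s', hss, by rw [hover j hj1 hj2, hE], ?_⟩
          rw [hw'_off s (by rw [hsj]; exact hj1) (by rw [hsj]; exact hj2),
            hw'_off s' (by rw [hs'j]; exact hj1) (by rw [hs'j]; exact hj2)]
          exact hws
      have hw0' : ∀ s ∈ (E.erase t₀).disjSum (E.erase t₀), w' s ≠ 0 := by
        intro s hs
        obtain ⟨hsE, -, -⟩ := mem_disjSum_erase.mp hs
        have h := hw0 s hsE
        rw [hw']
        split_ifs
        · exact mul_ne_zero (mul_ne_zero hc0 (hw0 _ hb)) h
        · exact mul_ne_zero (hw0 _ ha) h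
        · exact h
      have hu'' : ∀ j ∈ A.erase j₂, ∃ s ∈ activeOver π' (E.erase t₀) j,
          u' j * ∏ s' ∈ activeOver π' (E.erase t₀) j, w' s' = w' s ^ d := by
        intro j hj'
        obtain ⟨hj2, hjA⟩ := Finset.mem_erase.mp hj'
        by_cases hj1 : j = j₁
        · rw [hj1, hover₁, Finset.prod_pair hs₁₂, hu'₁]
          obtain ⟨p, hp, hup⟩ := hu j₁ hj₁A
          rw [hE₁', Finset.prod_pair hs₁a.symm] at hup
          rw [hE₁', Finset.mem_insert, Finset.mem_singleton] at hp
          obtain ⟨q, hq, huq⟩ := hu j₂ hj₂A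
          rw [hE₂', Finset.prod_pair hs₂b.symm] at huq
          rw [hE₂', Finset.mem_insert, Finset.mem_singleton] at hq
          have key : u j₁ * u j₂ / c t₀ * (w' s₁ * w' s₂) = w p ^ d * w q ^ d := by
            rw [hw'₁, hw'₂]
            calc u j₁ * u j₂ / c t₀ * (c t₀ * w (Sum.inr t₀) * w s₁ * (w (Sum.inl t₀) * w s₂))
                = u j₁ * (w (Sum.inl t₀) * w s₁) * (u j₂ * (w (Sum.inr t₀) * w s₂)) * (c t₀ / c t₀) := by ring
              _ = w p ^ d * w q ^ d := by rw [hup, huq, div_self hc0, mul_one]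
          have e1 : w s₁ ^ d = -(w (Sum.inl t₀) ^ d) := by linear_combination hw₁'
          have e2 : w s₂ ^ d = -(w (Sum.inr t₀) ^ d) := by linear_combination hw₂'
          have v1 : w' s₁ ^ d = w (Sum.inl t₀) ^ d * w (Sum.inr t₀) ^ d := by
            rw [hw'₁, mul_pow, mul_pow, hct₀, e1]; ring
          have v2 : w' s₂ ^ d = -(w (Sum.inl t₀) ^ d * w (Sum.inr t₀) ^ d) := by
            rw [hw'₂, mul_pow, e2]; ring
          rcases hp with hp | hp <;> rcases hq with hq | hq <;> rw [hp, hq] at key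
          · exact ⟨s₁, Finset.mem_insert_self _ _, by rw [key, v1]⟩
          · exact ⟨s₂, Finset.mem_insert.mpr (Or.inr (Finset.mem_singleton_self _)), by rw [key, v2, e2]; ring⟩
          · exact ⟨s₂, Finset.mem_insert.mpr (Or.inr (Finset.mem_singleton_self _)), by rw [key, v2, e1]; ring⟩
          · exact ⟨s₁, Finset.mem_insert_self _ _, by rw [key, v1, e1, e2]; ring⟩
        · obtain ⟨s, hs, hus⟩ := hu j hjA
          have hsj := (mem_activeOver.mp hs).2
          refine ⟨s, by rw [hover j hj1 hj2]; exact hs, ?_⟩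
          rw [hu'_of_ne j hj1, hover j hj1 hj2, hw'_off s (by rw [hsj]; exact hj1) (by rw [hsj]; exact hj2),
            Finset.prod_congr rfl fun s' hs' => hw'_off s' (by rw [(mem_activeOver.mp hs').2]; exact hj1)
              (by rw [(mem_activeOver.mp hs').2]; exact hj2)]
          exact hus
      -- the induction hypothesis for the glued configuration
      obtain ⟨z, hz⟩ := ih (E.erase t₀) (A.erase j₂) π' w' u' hcE' hact' htwo' hw0' hu''
        (fun t ht => hc t (Finset.mem_erase.mp ht).2)
      -- the substituted products are related by the gluing map
      have hglue : slotSubst π' w' (∏ t ∈ E.erase t₀, fermatLinearCycleFactor c (d - 1) t) =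
          mergeHom j₁ j₂ (w (Sum.inl t₀)) (c t₀ * w (Sum.inr t₀)) R := by
        rw [← hR, ← AlgHom.comp_apply]
        congr 1
        refine MvPolynomial.algHom_ext fun s => ?_
        simp only [AlgHom.comp_apply, slotSubst, mergeHom, aeval_X, map_mul, aeval_C, MvPolynomial.algebraMap_eq]
        by_cases h1 : π s = j₁
        · rw [hw'_on₁ s h1, hπ'_of_ne s (fun h => hj (h1.symm.trans h)), if_pos h1, h1]
          simp only [map_mul]
          ring
        · by_cases h2 : π s = j₂
          · rw [hw'_on₂ s h2, hπ'_of_eq s h2, if_neg h1, if_pos h2]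
            simp only [map_mul]
            ring
          · rw [hw'_off s h1 h2, hπ'_of_ne s h2, if_neg h1, if_neg h2]
      rw [hglue] at hz
      have htA' : targetExp d (A.erase j₂) j₁ = d - 2 := by
        rw [targetExp_apply, if_pos (Finset.mem_erase.mpr ⟨hj, hj₁A⟩)]
      have htA'2 : targetExp d (A.erase j₂) j₂ = 0 := by
        rw [targetExp_apply, if_neg (fun h => (Finset.mem_erase.mp h).1 rfl)]
      rw [coeff_mergeHom hj _ _ R _ htA'2, htA', show d - 2 + 1 = d - 1 by omega] at hz
      -- expand the factor of `t₀` against the target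
      have hexp : coeff (targetExp d A) (slotSubst π w (fermatLinearCycleFactor c (d - 1) t₀) * R) =
          ∑ l ∈ range (d - 1), w (Sum.inl t₀) ^ l * (c t₀ * w (Sum.inr t₀)) ^ (d - 2 - l) *
            coeff (((targetExp d (A.erase j₂)).update j₁ (d - 2 - l)).update j₂ l) R := by
        rw [slotSubst_fermatLinearCycleFactor_eq_sum_monomial, hj₁, hj₂, Finset.sum_mul, coeff_sum]
        refine Finset.sum_congr rfl fun l hl => ?_
        rw [Finset.mem_range] at hl
        have hle : Finsupp.single j₁ l + Finsupp.single j₂ (d - 1 - 1 - l) ≤ targetExp d A := by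
          refine Finsupp.le_def.mpr fun i => ?_
          rw [Finsupp.add_apply, targetExp_apply]
          by_cases hi1 : i = j₁
          · rw [hi1, Finsupp.single_eq_same, Finsupp.single_eq_of_ne hj, if_pos hj₁A]; omega
          · rw [Finsupp.single_eq_of_ne hi1]
            by_cases hi2 : i = j₂
            · rw [hi2, Finsupp.single_eq_same, if_pos hj₂A]; omega
            · rw [Finsupp.single_eq_of_ne hi2]; exact Nat.zero_le _
        rw [coeff_monomial_mul', if_pos hle, show d - 1 - 1 - l = d - 2 - l by omega]
        congr 2
        ext i
        rw [Finsupp.tsub_apply, Finsupp.add_apply, targetExp_apply]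
        by_cases hi2 : i = j₂
        · rw [hi2, upd_snd, Finsupp.single_eq_of_ne (Ne.symm hj), Finsupp.single_eq_same, if_pos hj₂A]; omega
        · by_cases hi1 : i = j₁
          · rw [hi1, upd_fst hj, Finsupp.single_eq_same, Finsupp.single_eq_of_ne hj, if_pos hj₁A]; omega
          · rw [upd_ne hi1 hi2, Finsupp.single_eq_of_ne hi1, Finsupp.single_eq_of_ne hi2, add_zero, tsub_zero,
              targetExp_apply]
            by_cases hiA : i ∈ A
            · rw [if_pos hiA, if_pos (Finset.mem_erase.mpr ⟨hi2, hiA⟩)]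
            · rw [if_neg hiA, if_neg (fun h => hiA (Finset.mem_erase.mp h).2)]
      refine ⟨z, ?_⟩
      rw [mul_assoc, hexp, hz, ← Finset.mul_prod_erase A u hj₂A,
        ← Finset.mul_prod_erase (A.erase j₂) u (Finset.mem_erase.mpr ⟨hj, hj₁A⟩),
        ← Finset.mul_prod_erase (A.erase j₂) u' (Finset.mem_erase.mpr ⟨hj, hj₁A⟩), hu'₁,
        Finset.prod_congr rfl fun x hx => hu'_of_ne x (Finset.mem_erase.mp hx).1]
      calc c t₀ * ((z : K) * (u j₁ * u j₂ / c t₀ * ∏ x ∈ (A.erase j₂).erase j₁, u x))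
          = (z : K) * (u j₂ * (u j₁ * ∏ x ∈ (A.erase j₂).erase j₁, u x)) * (c t₀ / c t₀) := by ring
        _ = (z : K) * (u j₂ * (u j₁ * ∏ x ∈ (A.erase j₂).erase j₁, u x)) := by rw [div_self hc0, mul_one]

/-! ## Two linear cycles of the Fermat variety -/

section TwoCycles

variable [Fintype ι] [DecidableEq ι] [Fintype T] [DecidableEq T]

/-- The target exponent on all pairs is the socle exponent `(d−2, …, d−2)`. [cite: Villaflor2022PeriodsCI, Corollary 4] -/
theorem targetExp_univ (d : ℕ) : targetExp d (univ : Finset ι) = fermatSocleExponent ι (d - 1) := by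
  ext j
  rw [targetExp_apply, if_pos (Finset.mem_univ j), fermatSocleExponent_apply]
  omega

omit [Fintype ι] [DecidableEq ι] [Fintype T] [DecidableEq T] in
/-- The slot substitution of the standard pairing seen through `ρ` is the restriction to the cycle composed
with the relabeling `rename ρ`. [cite: Villaflorloyola2021, Proposition 5.2] -/
theorem slotSubst_std (c : ι → K) (ρ : T ⊕ T ≃ ι ⊕ ι) (g : MvPolynomial (T ⊕ T) K) :
    slotSubst (Sum.elim id id ∘ ρ) (Sum.elim c (fun _ => 1) ∘ ρ) g = fermatLinearCycleSubst c (rename ρ g) := by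
  have h : slotSubst (Sum.elim id id ∘ ρ) (Sum.elim c (fun _ => (1 : K)) ∘ ρ) =
      (fermatLinearCycleSubst c).comp (rename ρ) := by
    refine MvPolynomial.algHom_ext fun s => ?_
    rw [slotSubst, aeval_X, AlgHom.comp_apply, rename_X, Function.comp_apply, Function.comp_apply]
    obtain ⟨x, rfl⟩ := ρ.symm.surjective s
    rw [Equiv.apply_symm_apply]
    rcases x with j | j
    · simp
    · simp
  rw [h, AlgHom.comp_apply]

/-- **The periods of a linear cycle over all linear cycles are integral** (algebraic core of Cor. 4 /
Props. 5.1–5.2, for two linear cycles in ARBITRARY mutual position `ρ`): for twists `c_j^d = −1 = c''_t^d`,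
`(∏_t c''_t) · ℓ_c(P_{c''} ∘ ρ) = z · ∏_j c_j^{−1}` with `z ∈ ℤ`.
[cite: Villaflor2022PeriodsCI, Corollary 4] [cite: Villaflorloyola2021, Propositions 5.1 and 5.2] -/
theorem linearCyclePairing_integral {d : ℕ} (hd : 2 ≤ d) (c : ι → K) (c'' : T → K) (hc : ∀ j, c j ^ d = -1)
    (hc'' : ∀ t, c'' t ^ d = -1) (ρ : T ⊕ T ≃ ι ⊕ ι) :
    ∃ z : ℤ, (∏ t, c'' t) *
        fermatLinearCycleFunctional c (d - 1) (rename ρ (fermatLinearCyclePolynomial c'' (d - 1))) =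
      z * ∏ j, (c j)⁻¹ := by
  have hc0 : ∀ j, c j ≠ 0 := fun j h => by
    have h' := hc j; rw [h, zero_pow (by omega)] at h'; norm_num at h'
  have hmem : ∀ s : T ⊕ T, s ∈ (univ : Finset T).disjSum univ := by
    rintro (t | t)
    · exact Finset.inl_mem_disjSum.mpr (Finset.mem_univ _)
    · exact Finset.inr_mem_disjSum.mpr (Finset.mem_univ _)
  have hval : ∀ x : ι ⊕ ι, (Sum.elim id id ∘ ρ) (ρ.symm x) = Sum.elim id id x ∧
      (Sum.elim c (fun _ => (1 : K)) ∘ ρ) (ρ.symm x) = Sum.elim c (fun _ => (1 : K)) x := fun x => by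
    constructor <;> rw [Function.comp_apply, Equiv.apply_symm_apply]
  have hne : ∀ j : ι, ρ.symm (Sum.inl j) ≠ ρ.symm (Sum.inr j) := fun j h =>
    Sum.inl_ne_inr (ρ.symm.injective h)
  have hactive : ∀ j : ι, activeOver (Sum.elim id id ∘ ρ) (univ : Finset T) j =
      {ρ.symm (Sum.inl j), ρ.symm (Sum.inr j)} := by
    intro j
    ext s
    rw [mem_activeOver, Finset.mem_insert, Finset.mem_singleton]
    constructor
    · rintro ⟨-, hs⟩
      obtain ⟨x, rfl⟩ := ρ.symm.surjective s
      rw [(hval x).1] at hs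
      rcases x with i | i
      · exact Or.inl (by rw [show i = j from hs])
      · exact Or.inr (by rw [show i = j from hs])
    · rintro (h | h) <;> rw [h]
      · exact ⟨hmem _, (hval (Sum.inl j)).1⟩
      · exact ⟨hmem _, (hval (Sum.inr j)).1⟩
  have htwo : ∀ j ∈ (univ : Finset ι), ∃ s s', s ≠ s' ∧
      activeOver (Sum.elim id id ∘ ρ) (univ : Finset T) j = {s, s'} ∧
      (Sum.elim c (fun _ => (1 : K)) ∘ ρ) s ^ d + (Sum.elim c (fun _ => (1 : K)) ∘ ρ) s' ^ d = 0 := by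
    intro j _
    refine ⟨ρ.symm (Sum.inl j), ρ.symm (Sum.inr j), hne j, hactive j, ?_⟩
    rw [(hval (Sum.inl j)).2, (hval (Sum.inr j)).2, Sum.elim_inl, Sum.elim_inr, hc j, one_pow]
    norm_num
  have hw0 : ∀ s ∈ (univ : Finset T).disjSum univ, (Sum.elim c (fun _ => (1 : K)) ∘ ρ) s ≠ 0 := by
    intro s _
    obtain ⟨x, rfl⟩ := ρ.symm.surjective s
    rw [(hval x).2]
    rcases x with j | j
    · exact hc0 j
    · exact one_ne_zero
  have hu : ∀ j ∈ (univ : Finset ι), ∃ s ∈ activeOver (Sum.elim id id ∘ ρ) (univ : Finset T) j,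
      (c j)⁻¹ * ∏ s' ∈ activeOver (Sum.elim id id ∘ ρ) (univ : Finset T) j,
        (Sum.elim c (fun _ => (1 : K)) ∘ ρ) s' = (Sum.elim c (fun _ => (1 : K)) ∘ ρ) s ^ d := by
    intro j _
    refine ⟨ρ.symm (Sum.inr j), by rw [hactive]; exact Finset.mem_insert.mpr (Or.inr (Finset.mem_singleton_self _)), ?_⟩
    rw [hactive, Finset.prod_pair (hne j), (hval (Sum.inl j)).2, (hval (Sum.inr j)).2, Sum.elim_inl, Sum.elim_inr,
      one_pow, mul_one, inv_mul_cancel₀ (hc0 j)]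
  obtain ⟨z, hz⟩ := slotSubst_prod_integral d hd c'' (Fintype.card T) univ univ (Sum.elim id id ∘ ρ)
    (Sum.elim c (fun _ => (1 : K)) ∘ ρ) (fun j => (c j)⁻¹) Finset.card_univ (fun s _ => Finset.mem_univ _)
    htwo hw0 hu (fun t _ => hc'' t)
  refine ⟨z, ?_⟩
  rw [fermatLinearCycleFunctional_apply, ← slotSubst_std, ← targetExp_univ d, fermatLinearCyclePolynomial]
  exact hz

/-- Equivalently: the socle coefficient `(∏ c_j)(∏ c''_t)·ℓ_c(P_{c''} ∘ ρ)` of the product of the two normalised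
linear-cycle polynomials is an INTEGER (Cor. 4: `c(d−1)^{n+2} = (1−d)^{m+1}` in the same-pairing case).
[cite: Villaflor2022PeriodsCI, Corollary 4] [cite: Villaflorloyola2021, Proposition 5.1] -/
theorem linearCyclePairing_integral' {d : ℕ} (hd : 2 ≤ d) (c : ι → K) (c'' : T → K) (hc : ∀ j, c j ^ d = -1)
    (hc'' : ∀ t, c'' t ^ d = -1) (ρ : T ⊕ T ≃ ι ⊕ ι) :
    ∃ z : ℤ, (∏ j, c j) * (∏ t, c'' t) *
        fermatLinearCycleFunctional c (d - 1) (rename ρ (fermatLinearCyclePolynomial c'' (d - 1))) = z := by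
  have hc0 : ∀ j, c j ≠ 0 := fun j h => by
    have h' := hc j; rw [h, zero_pow (by omega)] at h'; norm_num at h'
  obtain ⟨z, hz⟩ := linearCyclePairing_integral hd c c'' hc hc'' ρ
  refine ⟨z, ?_⟩
  rw [mul_assoc, hz, mul_left_comm, ← Finset.prod_mul_distrib,
    Finset.prod_eq_one (fun j _ => mul_inv_cancel₀ (hc0 j)), mul_one]

/-- **(H2) holds for genuine linear cycles.** For the period functional `ℓ = c'·ℓ_c ∘ rename θ₀⁻¹` of a linear
cycle `(θ₀, c)` of the Fermat variety (`c_j^d = −1`) and `c₀ := c'·∏ c_j^{−1}`, the period `ℓ(P_δ/c_δ)` over EVERY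
linear cycle `δ = (θ, c'')` (`linearCyclePoly`) is a rational — indeed integral — multiple of `c₀`: hypothesis (H2)
of `exists_fakeLinearCycle_of_rational_periods` / `exists_linearCycle_of_rational_periods` is satisfied by the
linear cycles themselves. [cite: Villaflorloyola2021, Propositions 5.1 and 5.2, §6]
[cite: Villaflor2022PeriodsCI, Corollary 4] -/
theorem linearCycle_rational_periods {m k d : ℕ} (hd : 2 ≤ d) (θ₀ : Fin (k + 1) ⊕ Fin (k + 1) ≃ Fin m)
    (c : Fin (k + 1) → K) (hc : ∀ j, c j ^ d = -1) (c' : K) :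
    ∃ c₀ : K, ∀ (θ : Fin (k + 1) ⊕ Fin (k + 1) ≃ Fin m) (c'' : Fin (k + 1) → K), (∀ j, c'' j ^ d = -1) →
      ∃ q : ℚ, (c' • (fermatLinearCycleFunctional c (d - 1) ∘ₗ
          (rename θ₀.symm : MvPolynomial (Fin m) K →ₐ[K] MvPolynomial (Fin (k + 1) ⊕ Fin (k + 1)) K).toLinearMap))
        (linearCyclePoly (d - 1) θ c'') = (q : K) * c₀ := by
  refine ⟨c' * ∏ j, (c j)⁻¹, fun θ c'' hc'' => ?_⟩
  obtain ⟨z, hz⟩ := linearCyclePairing_integral hd c c'' hc hc'' (θ.trans θ₀.symm)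
  refine ⟨z, ?_⟩
  rw [LinearMap.smul_apply, LinearMap.comp_apply, AlgHom.toLinearMap_apply, linearCyclePoly, map_mul, rename_C,
    rename_rename, fermatLinearCycleFunctional_apply, map_mul, fermatLinearCycleSubst_C, coeff_C_mul,
    ← fermatLinearCycleFunctional_apply, ← Equiv.coe_trans, hz, smul_eq_mul]
  push_cast
  ring

end TwoCycles

end Literature.AlgebraicGeometry.Villaflor2022

end
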